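import Summits.HodgeConjecture.HodgeConjecture.Theses.SecondaryPeriods
import Literature.AlgebraicGeometry.HodgeTheory.ComplexGysinCorrespondence
import Literature.AlgebraicGeometry.HodgeTheory.HodgeClassOfMorphism
import Literature.AlgebraicGeometry.HodgeTheory.HodgeClassOfMorphismProofs
import Literature.AlgebraicGeometry.HodgeTheory.LevelOneSubHodgeStructuresOfCurves
import Literature.AlgebraicGeometry.HodgeTheory.LevelOneSubHodgeStructuresOfCurvesProofs
import Literature.AlgebraicGeometry.HodgeTheory.MotivatedClassesProofs
import Literature.AlgebraicGeometry.HodgeTheory.GysinKernelProofs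
import Literature.AlgebraicGeometry.Motives.ComplexPointsOrientation

/-!
# `HodgeImpliesConiveauOne` (route `SecondaryPeriods`, item stmt-HodgeConjecture-3541):
# Grothendieck's observation HC ⟹ GHC(3,1) for threefolds — the correspondence half, proved

Work file. Grothendieck (Topology 8 (1969), p. 301) / Abdulali (in Kerr–Pearlstein 2016,
Prop. 3.2): if `Y` is dominated by a class `𝒳` and the Hodge conjecture holds for `Y × X`,
`X ∈ 𝒳`, then the generalised Hodge conjecture holds for `Y`. For a level-one sub-Hodge structure
`V ⊂ H³(Y, ℚ)` of a threefold the dominating variety is a curve `C` (Riemann: `V(1) = H¹(A)` for an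
abelian variety `A`, a quotient of a Jacobian `J(C)`), and the Hodge class on `Y × C` inducing
`H¹(C)(−1) ↠ V` is, by the Hodge conjecture on the fourfold `Y × C`, an algebraic class
`γ ∈ N²H⁴(Y × C)`; the action of such a class maps `H¹(C)` into `N¹H³(Y)`.

This file PROVES the second half on the tree's real carriers:
* `corrAction_mem_supportedClasses` — for `γ ∈ Nʳ H^{2e}((W ⊗ X)(ℂ))`, the correspondence action
  `γ_* : Hᵃ(X(ℂ)) → Hᵇ(W(ℂ))`, `γ_*(c) = pr_{W*}(pr_X^* c ∪ γ)` (`corrAction`), takes values in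
  `Nˢ Hᵇ(W(ℂ))` whenever `s + dim X ≤ r` (Gysin support property
  `gysinMap_mem_supportedClasses_of_isSmoothProjective` and naturality of `∪`);
* `range_corrAction_le_supportedClasses_of_hodgeConjecture` — under the Hodge conjecture (applied
  to the FOURFOLD `Y ⊗ C`), a rational `(2,2)`-class on `Y ⊗ C` acts `H¹(C(ℂ)) → N¹H³(Y(ℂ))`;
* `hodgeImpliesConiveauOne_of_curve_of_hodgeClass` — the assembly of `HodgeImpliesConiveauOne` from
  the two Hodge-theoretic inputs, spelled out as hypotheses: (A) the level-one sub-Hodge structure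
  is the image of `H¹(C(ℂ))`, `C` a smooth projective curve, under a rational map `φ` of type
  `(1,1)` (Riemann's theorem: the named fact `levelOne_subHodge_eq_range_of_curve`, reduced in
  `Literature/…/LevelOneSubHodgeStructuresOfCurvesProofs` to Riemann's theorem on the abstract layer,
  `weightOne_polarizable_eq_range_of_curve`, and Hodge–Riemann polarisability); (B) `φ = t⁻¹ • γ_*`
  for a rational `(2,2)`-class `γ` on `Y ⊗ C` (Voisin I Lemma 11.41, PROVED in
  `Literature/…/HodgeClassOfMorphismProofs`). The theorems taking the named facts themselves are
  appended as those Literature files land.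
-/

noncomputable section

-- `Summit.HodgeConjecture.HodgeConjecture.Theorems` is the mandated namespace (single-conjunct summit:
-- Sub = Summit), which `linter.dupNamespace` flags on every declaration; the lakefile turns the
-- linter off tree-wide (weak option), restated here so stand-alone elaboration is warning-free too.
set_option linter.dupNamespace false

open scoped Manifold
open CategoryTheory AlgebraicGeometry MonoidalCategory CartesianMonoidalCategory
open Literature.AlgebraicTopology.SingularHomology
open Literature.AlgebraicGeometry Literature.AlgebraicGeometry.Motives
open Literature.AlgebraicGeometry.HodgeTheory

namespace Summit.HodgeConjecture.HodgeConjecture.Theorems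

/-! ### The action of a supported class lands in supported classes -/

section CorrAction

variable (μ : OrientationFamily) {m n : ℕ} {W X : SchemeOver ℂ}

/-- **Cup product with a class supported in codimension `≥ r` is supported in codimension `≥ r`**:
if `γ` dies off a Zariski-closed `Z`, so does `x ∪ γ` (naturality of `∪` under restriction).
[cite: Fulton1998, §19.2 Cor. 19.2] -/
theorem cupProduct_mem_supportedClasses_right {p q k : ℕ} (hpq : p + q = k) {r : ℕ}
    (x : complexBetti X p) {γ : complexBetti X q} (hγ : γ ∈ supportedClasses X q r) :
    cupProduct hpq x γ ∈ supportedClasses X k r := by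
  suffices h : supportedClasses X q r ≤ (supportedClasses X k r).comap (cupProduct hpq x) from h hγ
  refine iSup_le fun Z ↦ iSup_le fun hZ ↦ iSup_le fun hr ↦ fun γ' hγ' ↦ ?_
  rw [Submodule.mem_comap]
  refine mem_supportedClasses_of_restrictCompl_eq_zero hZ hr ?_
  rw [LinearMap.mem_ker] at hγ'
  change singularCohomology.map ℂ ℂ _ k (cupProduct hpq x γ') = 0
  rw [cupProduct_map]
  change cupProduct hpq _ (complexBetti.restrictCompl X Z q γ') = 0
  rw [hγ', map_zero]

/-- **The action of a class supported in codimension `≥ r` on `W ⊗ X` takes values in the classes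
supported in codimension `≥ s` on `W`, `s + dim X ≤ r`**: `γ_*(c) = pr_{W*}(pr_X^* c ∪ γ)`;
`pr_X^* c ∪ γ` is supported where `γ` is, and the Gysin morphism of the (proper) projection
`pr_W` maps classes dying off a closed `T` to classes dying off `pr_W(T)`, whose codimension is
at least `codim T - dim X` (Borel–Moore base change in support form, the tree's
`gysinMap_mem_supportedClasses_of_isSmoothProjective`). This is the mechanism of Grothendieck's
remark that the Hodge conjecture on `Y × X` bounds the coniveau of the image of a correspondence.
[cite: GrothendieckTopology1969, p. 301] [cite: FultonYoungTableaux1997, Appendix B §B.2 Exercise 5] -/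
theorem corrAction_mem_supportedClasses (hW : IsSmoothProjective m W) (hX : IsSmoothProjective n X)
    {e a b : ℕ} (hab : a + 2 * e = b + 2 * n) {r s : ℕ} (hrs : s + n ≤ r)
    {γ : complexBetti (W ⊗ X) (2 * e)} (hγ : γ ∈ supportedClasses (W ⊗ X) (2 * e) r)
    (c : complexBetti X a) :
    corrAction μ hW hX hab γ c ∈ supportedClasses W b s := by
  rw [corrAction_apply]
  have hcup := cupProduct_mem_supportedClasses_right (X := W ⊗ X) (rfl : a + 2 * e = a + 2 * e)
    (complexBetti.map (snd W X) a c) hγ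
  by_cases h : a + 2 * e ≤ 2 * (m + n)
  · rw [complexGysin_eq_gysinMap (IsSmoothProjective.tensor_holds hW hX) hW (fst W X)
      (corrAction_degree m hab) (q := 2 * (m + n) - (a + 2 * e)) (by omega) (by omega)]
    exact gysinMap_mem_supportedClasses_of_isSmoothProjective (IsSmoothProjective.tensor_holds hW hX)
      hW (μ _) (μ hW) (OrientationFamily.hasPoincareDuality μ hW) (fst W X) _ _ (by omega) hcup
  · rw [complexGysin_of_lt (IsSmoothProjective.tensor_holds hW hX) hW (fst W X)
      (corrAction_degree m hab) (not_le.1 h), LinearMap.zero_apply]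
    exact Submodule.zero_mem _

/-- The range form: for `γ ∈ Nʳ H^{2e}((W ⊗ X)(ℂ))` and `s + dim X ≤ r`, `im γ_* ⊆ Nˢ Hᵇ(W(ℂ))`.
[cite: GrothendieckTopology1969, p. 301] -/
theorem range_corrAction_le_supportedClasses (hW : IsSmoothProjective m W)
    (hX : IsSmoothProjective n X) {e a b : ℕ} (hab : a + 2 * e = b + 2 * n) {r s : ℕ}
    (hrs : s + n ≤ r) {γ : complexBetti (W ⊗ X) (2 * e)}
    (hγ : γ ∈ supportedClasses (W ⊗ X) (2 * e) r) :
    LinearMap.range (corrAction μ hW hX hab γ) ≤ supportedClasses W b s := by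
  rintro _ ⟨c, rfl⟩
  exact corrAction_mem_supportedClasses μ hW hX hab hrs hγ c

end CorrAction

/-! ### The Hodge conjecture on `Y ⊗ C` bounds the coniveau of the image of a Hodge correspondence -/

/-- **Grothendieck's observation, correspondence form.** If the Hodge conjecture holds, then for a
smooth projective threefold `Y`, a smooth projective curve `C` and a RATIONAL class
`γ ∈ H⁴((Y ⊗ C)(ℂ); ℂ)` of Hodge type `(2, 2)`, the image of `γ_* : H¹(C(ℂ)) → H³(Y(ℂ))` lies in
`N¹H³(Y(ℂ))`: by the Hodge conjecture for the fourfold `Y ⊗ C`, `γ ∈ N²H⁴((Y ⊗ C)(ℂ))`, and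
`corrAction_mem_supportedClasses` applies with `r = 2`, `s = 1`, `dim C = 1`.
[cite: GrothendieckTopology1969, p. 301] [cite: VoisinHodgeI2002, §11.3.3] -/
theorem range_corrAction_le_supportedClasses_of_hodgeConjecture (hHC : _root_.HodgeConjecture)
    (μ : OrientationFamily) {Y C : SchemeOver ℂ} (hY : IsSmoothProjective 3 Y)
    (hC : IsSmoothProjective 1 C) {γ : complexBetti (Y ⊗ C) (2 * 2)} (hγ : IsRationalClass γ)
    (hγH : IsOfHodgeType (3 + 1) (Y ⊗ C) (2 * 2) 2 2 γ) :
    LinearMap.range (corrAction μ hY hC (show 1 + 2 * 2 = 3 + 2 * 1 by norm_num) γ) ≤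
      supportedClasses Y 3 1 := by
  have halg : γ ∈ algebraicClasses (Y ⊗ C) 2 :=
    (hHC (IsSmoothProjective.tensor_holds hY hC)).2 2 γ hγ hγH
  exact range_corrAction_le_supportedClasses μ hY hC _ (by norm_num) halg

/-! ### Assembly -/

/-- **`HodgeImpliesConiveauOne` from the two Hodge-theoretic inputs** (the shapes of the
unfoldings `levelOne_subHodge_eq_range_of_curve.threefold_span` — Riemann's theorem: a rational
level-one sub-Hodge structure of `H³` of a threefold is the image of `H¹` of a smooth projective
curve under a rational map `φ` of type `(1,1)` — and
`exists_hodgeClass_corrAction_eq_smul.threefold_curve` — Voisin I Lemma 11.41: such a `φ` is, up to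
a non-zero scalar, the action of a rational `(2,2)`-class `γ` on `Y ⊗ C`): by the Hodge conjecture
for the fourfold `Y ⊗ C`, `γ` is algebraic, so `W = im φ = im γ_* ⊆ N¹H³(Y)`
(`range_corrAction_le_supportedClasses_of_hodgeConjecture`). [cite: GrothendieckTopology1969, p. 301]
[cite: KerrPearlstein2016, Ch. 11 (Abdulali) Prop. 3.2 p. 291] -/
theorem hodgeImpliesConiveauOne_of_curve_of_hodgeClass
    (hA : ∀ ⦃Y : SchemeOver ℂ⦄ (hY : IsSmoothProjective 3 Y) (A : HodgeModel 3 Y)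
      (s : Finset (complexBetti Y 3)), (∀ c ∈ s, IsRationalClass c) →
      (Submodule.span ℂ (↑s : Set (complexBetti Y 3))).map (A.pullback 3).hom =
        (⨆ (p : ℕ) (q : ℕ) (_ : p + q = 3),
          (Submodule.span ℂ (↑s : Set (complexBetti Y 3))).map (A.pullback 3).hom ⊓
            A.hodgePQ 3 p q) →
      (Submodule.span ℂ (↑s : Set (complexBetti Y 3))).map (A.pullback 3).hom ≤
        (⨆ (p : ℕ) (q : ℕ) (_ : p + q = 3) (_ : 1 ≤ p) (_ : 1 ≤ q), A.hodgePQ 3 p q) →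
      ∃ (C : SchemeOver ℂ) (_ : IsSmoothProjective 1 C) (B : HodgeModel 1 C)
        (φ : complexBetti C 1 →ₗ[ℂ] complexBetti Y 3),
        (∀ c, IsRationalClass c → IsRationalClass (φ c)) ∧
        (∀ (p q : ℕ), p + q = 1 → ∀ c, B.pullback 1 c ∈ B.hodgePQ 1 p q →
          A.pullback 3 (φ c) ∈ A.hodgePQ 3 (p + 1) (q + 1)) ∧
        LinearMap.range φ = Submodule.span ℂ (↑s : Set (complexBetti Y 3)))
    (hB : ∀ ⦃Y C : SchemeOver ℂ⦄ (hY : IsSmoothProjective 3 Y) (hC : IsSmoothProjective 1 C)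
      (A : HodgeModel 3 Y) (B : HodgeModel 1 C) (φ : complexBetti C 1 →ₗ[ℂ] complexBetti Y 3),
      (∀ c, IsRationalClass c → IsRationalClass (φ c)) →
      (∀ (p q : ℕ), p + q = 1 → ∀ c, B.pullback 1 c ∈ B.hodgePQ 1 p q →
        A.pullback 3 (φ c) ∈ A.hodgePQ 3 (p + 1) (q + 1)) →
      ∀ (μ : OrientationFamily), ∃ γ : complexBetti (Y ⊗ C) (2 * 2),
        IsRationalClass γ ∧ IsOfHodgeType (3 + 1) (Y ⊗ C) (2 * 2) 2 2 γ ∧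
        ∃ t : ℂ, t ≠ 0 ∧ corrAction μ hY hC (show 1 + 2 * 2 = 3 + 2 * 1 by norm_num) γ = t • φ) :
    Theses.SecondaryPeriods.HodgeImpliesConiveauOne := by
  intro hHC Y hY A s hs hsub hlev
  obtain ⟨μ⟩ : Nonempty OrientationFamily :=
    ⟨fun _ _ h ↦ Classical.choice (ComplexPoints.isOrientableOver ℂ h)⟩
  obtain ⟨C, hC, B, φ, hφ, hφH, hrange⟩ := hA hY A s hs hsub hlev
  obtain ⟨γ, hγ, hγH, t, ht, heq⟩ := hB hY hC A B φ hφ hφH μ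
  rw [← hrange, ← LinearMap.range_smul φ t ht, ← heq]
  exact range_corrAction_le_supportedClasses_of_hodgeConjecture hHC μ hY hC hγ hγH

/-! ### Appended (v2): the assembly from the named facts of the tree -/

/-- **`HodgeImpliesConiveauOne`, conditionally on the two Hodge-theoretic named facts**
`levelOne_subHodge_eq_range_of_curve` (Riemann's theorem: a rational level-one sub-Hodge structure
`W` of `H³` of a threefold is the image of `H¹` of a smooth projective curve `C` under a rational map
`φ` of type `(1,1)`) and `exists_hodgeClass_corrAction_eq_smul` (Voisin I Lemma 11.41: such a `φ`
is, up to a non-zero scalar, the action of a rational `(2,2)`-class `γ` on `Y ⊗ C`): by the Hodge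
conjecture for the fourfold `Y ⊗ C`, `γ` is algebraic, so `W = im φ = im γ_* ⊆ N¹H³(Y)`
(`range_corrAction_le_supportedClasses_of_hodgeConjecture`) — Grothendieck's observation
HC ⟹ GHC(3,1). [cite: GrothendieckTopology1969, p. 301]
[cite: KerrPearlstein2016, Ch. 11 (Abdulali) Prop. 3.2 p. 291] -/
theorem hodgeImpliesConiveauOne_of_facts (hA : levelOne_subHodge_eq_range_of_curve)
    (hB : exists_hodgeClass_corrAction_eq_smul) :
    Theses.SecondaryPeriods.HodgeImpliesConiveauOne := by
  intro hHC Y hY A s hs hsub hlev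
  obtain ⟨μ⟩ : Nonempty OrientationFamily :=
    ⟨fun _ _ h ↦ Classical.choice (ComplexPoints.isOrientableOver ℂ h)⟩
  obtain ⟨C, hC, B, φ, hφ, hφH, hrange⟩ :=
    levelOne_subHodge_eq_range_of_curve.threefold_span hA hY A s hs hsub hlev
  obtain ⟨γ, hγ, hγH, t, ht, heq⟩ :=
    exists_hodgeClass_corrAction_eq_smul.threefold_curve hB hY hC A B φ hφ hφH μ
  rw [← hrange, ← LinearMap.range_smul φ t ht, ← heq]
  exact range_corrAction_le_supportedClasses_of_hodgeConjecture hHC μ hY hC hγ hγH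

/-- **`HodgeImpliesConiveauOne` from Riemann's theorem and de Rham's theorem in multiplicative
form** — the trust base reduced to ONE new named fact: `levelOne_subHodge_eq_range_of_curve`
(Riemann: the level-one sub-Hodge structure is `im φ` for a rational type-`(1,1)` map
`φ : H¹(C(ℂ)) → H³(Y(ℂ))`, `C` a smooth projective curve) and the tree's
`exists_deRhamIsoFamily` (Warner Thm. 5.45, wedge ↦ cup), through the PROVED Lemma 11.41
`exists_hodgeClass_corrAction_eq_smul_of_multiplicative_deRham` (`φ = t⁻¹ • γ_*` for a rational
`(2,2)`-class `γ` on `Y ⊗ C`) and the Hodge conjecture on the fourfold `Y ⊗ C`.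
[cite: GrothendieckTopology1969, p. 301] [cite: VoisinHodgeI2002, §11.3.3 Lemma 11.41] -/
theorem hodgeImpliesConiveauOne_of_curve_of_deRham (hA : levelOne_subHodge_eq_range_of_curve)
    (hdR : ∀ (E : Type) [NormedAddCommGroup E] [NormedSpace ℂ E] [FiniteDimensional ℂ E],
      Literature.NumberTheory.Transcendental.exists_deRhamIsoFamily 𝓘(ℝ, E)) :
    Theses.SecondaryPeriods.HodgeImpliesConiveauOne := by
  intro hHC Y hY A s hs hsub hlev
  obtain ⟨μ⟩ : Nonempty OrientationFamily :=
    ⟨fun _ _ h ↦ Classical.choice (ComplexPoints.isOrientableOver ℂ h)⟩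
  obtain ⟨C, hC, B, φ, hφ, hφH, hrange⟩ :=
    levelOne_subHodge_eq_range_of_curve.threefold_span hA hY A s hs hsub hlev
  obtain ⟨γ, hγ, hγH, t, ht, heq⟩ :=
    exists_hodgeClass_corrAction_eq_smul_of_multiplicative_deRham hdR hY hC A B
      (show 1 + 2 * 2 = 3 + 2 * 1 by norm_num) (show 1 + 1 = 2 by norm_num) φ hφ hφH μ
  rw [← hrange, ← LinearMap.range_smul φ t ht, ← heq]
  exact range_corrAction_le_supportedClasses_of_hodgeConjecture hHC μ hY hC hγ hγH

/-- **`HodgeImpliesConiveauOne` from Riemann's theorem ALONE** — Grothendieck's observation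
HC ⟹ GHC(3,1) for threefolds with trust base exactly ONE named fact,
`levelOne_subHodge_eq_range_of_curve` (a rational level-one sub-Hodge structure of `H³` of a
threefold is the image of `H¹` of a smooth projective curve under a rational map of type `(1,1)`;
Riemann + abelian varieties as quotients of Jacobians): Lemma 11.41 is the tree's unconditional
`exists_rational_hodgeClass_corrAction_eq_smul`, and the coniveau bound is the Hodge conjecture on
the fourfold `Y ⊗ C`. [cite: GrothendieckTopology1969, p. 301]
[cite: KerrPearlstein2016, Ch. 11 (Abdulali) §1 p. 288 and Prop. 3.2 p. 291] -/
theorem hodgeImpliesConiveauOne_of_levelOne_subHodge_eq_range_of_curve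
    (hA : levelOne_subHodge_eq_range_of_curve) :
    Theses.SecondaryPeriods.HodgeImpliesConiveauOne := by
  intro hHC Y hY A s hs hsub hlev
  obtain ⟨μ⟩ : Nonempty OrientationFamily :=
    ⟨fun _ _ h ↦ Classical.choice (ComplexPoints.isOrientableOver ℂ h)⟩
  obtain ⟨C, hC, B, φ, hφ, hφH, hrange⟩ :=
    levelOne_subHodge_eq_range_of_curve.threefold_span hA hY A s hs hsub hlev
  obtain ⟨γ, hγ, hγH, t, ht, heq⟩ :=
    exists_rational_hodgeClass_corrAction_eq_smul hY hC A B
      (show 1 + 2 * 2 = 3 + 2 * 1 by norm_num) (show 1 + 1 = 2 by norm_num) φ hφ hφH μ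
  rw [← hrange, ← LinearMap.range_smul φ t ht, ← heq]
  exact range_corrAction_le_supportedClasses_of_hodgeConjecture hHC μ hY hC hγ hγH


/-- **`HodgeImpliesConiveauOne` from Riemann's theorem on the abstract layer and Hodge–Riemann
polarisability** — the final trust base of Grothendieck's observation HC ⟹ GHC(3,1) on the tree's
carriers: `weightOne_polarizable_eq_range_of_curve` (a polarisable effective weight-one rational Hodge
structure is a quotient of `H¹` of a smooth projective curve: Riemann's theorem and abelian varieties
as quotients of Jacobians) and `smoothProjective_hodgeStructure_isPolarizable` (the Hodge structure on
`Hᵏ(Y(ℂ); ℚ)` of a smooth projective `Y` is polarisable): the level-one sub-Hodge structure is the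
image of `H¹(C)` under a rational type-`(1,1)` map `φ` (`exists_curve_of_levelOne_threefold_span`,
PROVED reduction), `φ = t⁻¹ • γ_*` for a rational `(2,2)`-class `γ` on `Y ⊗ C` (Voisin I Lemma 11.41,
the tree's unconditional `exists_rational_hodgeClass_corrAction_eq_smul`), and HC on the fourfold
`Y ⊗ C` bounds the coniveau of `im γ_*`. [cite: GrothendieckTopology1969, p. 301]
[cite: KerrPearlstein2016, Ch. 11 (Abdulali) §1 p. 288 and Prop. 3.2 p. 291] -/
theorem hodgeImpliesConiveauOne_of_weightOne_of_polarizable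
    (h0 : weightOne_polarizable_eq_range_of_curve)
    (hpol : smoothProjective_hodgeStructure_isPolarizable) :
    Theses.SecondaryPeriods.HodgeImpliesConiveauOne := by
  intro hHC Y hY A s hs hsub hlev
  obtain ⟨μ⟩ : Nonempty OrientationFamily :=
    ⟨fun _ _ h ↦ Classical.choice (ComplexPoints.isOrientableOver ℂ h)⟩
  obtain ⟨C, hC, B, φ, hφ, hφH, hrange⟩ :=
    exists_curve_of_levelOne_threefold_span h0 hpol hY A s hs hsub hlev
  obtain ⟨γ, hγ, hγH, t, ht, heq⟩ :=
    exists_rational_hodgeClass_corrAction_eq_smul hY hC A B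
      (show 1 + 2 * 2 = 3 + 2 * 1 by norm_num) (show 1 + 1 = 2 by norm_num) φ hφ hφH μ
  rw [← hrange, ← LinearMap.range_smul φ t ht, ← heq]
  exact range_corrAction_le_supportedClasses_of_hodgeConjecture hHC μ hY hC hγ hγH

end Summit.HodgeConjecture.HodgeConjecture.Theorems

end
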